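import Literature.AnabelianGeometry.EtaleTheta.BiKummerThm44SubNHSatFaithful
import HarnessLib

/-!
# [EtTh] Thm 4.4 (iii): T44-L15b and Thm 4.4 (i)∧(ii)∧(iii)∧roots AT THE FAITHFUL SLOT «`def22Ctx A` is `(N, H)`-saturated» (proof-only)

S. Mochizuki, *The étale theta function …* [MochizukiEtTh2009], Thm 4.4 (iii) p.95 l.14–16, Def 4.1 (iii)(a) p.87; *The geometry of
Frobenioids II* [MochizukiFrdII2008], Def 2.2 (ii) p.17.

abc-iut-w6-d047 (gen 3).  The free `(N, H)`-saturation slot of abc-iut-L2-t4's `mkOfConnectedTemperoid` INSTANTIATED by the faithful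
[FrdII] Def 2.2 (ii) reading through the context of record `def22Ctx` (p460958) — the SAME inline slot as abc-iut-w4-d044's
`Prop42Sub.prop42_iii_iv_mkOfConnectedTemperoid_faithful` (p466882):
`fun H A N => ∃ (hn : H.Normal) (ho : IsOpen H), PadicKummer.IsNHSaturated (def22Ctx X tf haug A (act A) (hact A) H hn ho) N`.
At this slot the reading hypotheses `hNH_i` of `preservesNHSaturatedBsFld_mkOfConnectedTemperoid_faithful` (p461844) are `Iff`s by proof
irrelevance, so:
* `Thm44Hyp.preservesNHSaturatedBsFld_faithfulSlot` — **T44-L15b ⟸ `hΔ` ([AbsAnab] Lem 1.3.8 ∀-form) ONLY** (the hull data, `haug_i`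
  and the descended actions `act_i`/`hact_i` are parameters OF THE SETTINGS, not hypotheses of the theorem);
* `Thm44Hyp.thm44_mkOfConnectedTemperoid_faithfulSlot` — **[EtTh] Thm 4.4 (i)∧(ii)∧(iii)∧(`N`-th roots) at tree vocabulary ⟸ {`C_i` Frobenioid,
  T44-L03 `h3`, `hBD_i`, `hΔ`}** (abc-iut-w5-d179's p436787 with `h15` discharged at the slot).
PROOF-ONLY (0 definitions; the slot is an inline term).  Nothing here bears on [IUTchIII] Cor 3.12; typed ≠ proved for `hΔ`.
-/

noncomputable section

namespace Literature.AnabelianGeometry.EtaleTheta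

open CategoryTheory Opposite Literature.AlgebraicGeometry.Frobenioids Literature.AlgebraicGeometry.Frobenioids.QuasiTemperoid
  Literature.AnabelianGeometry.SemiGraphs Literature.AnabelianGeometry.SemiGraphs.GaloisObjects
  Literature.AnabelianGeometry.EtaleTheta.CnstPushforward

namespace BiKummerSetting

variable {K : Type} [Field K] {K' : Type} [Field K'] {X₁ : SemiGraphs.TemperedArithmeticGroup.{0} K}
  {X₂ : SemiGraphs.TemperedArithmeticGroup.{0} K'} {D₀ : Type} [Category.{0} D₀] {D₀' : Type}
  [Category.{0} D₀'] {V : FrdIMonoidStub.{0}} {T₁ : RealifiedDivisorMonoids (D₀ := D₀) V}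
  {T₂ : RealifiedDivisorMonoids (D₀ := D₀') V}
  {VD₁ : FrdICatStub.{1, 0, 0} (ConnectedPart (BTemp X₁.Pi))}
  {VD₂ : FrdICatStub.{1, 0, 0} (ConnectedPart (BTemp X₂.Pi))}
  {tf₁ : TemperedFrobenioid T₁ (ConnectedPart (BTemp X₁.Pi)) VD₁} {hZ₁ : tf₁.monoidType = MonoidType.Z}
  {hP₁ : ∀ A : (ConnectedPart (BTemp X₁.Pi))ᵒᵖ, IsPerfect (tf₁.Φ.carrier A)}
  {A₁ : tf₁.category}
  {hA₁ : PreFrobenioid.IsFrobeniusTrivial tf₁.toElem A₁} {hA₁' : SemiGraphs.IsGaloisObj A₁.base.obj}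
  {tf₂ : TemperedFrobenioid T₂ (ConnectedPart (BTemp X₂.Pi)) VD₂} {hZ₂ : tf₂.monoidType = MonoidType.Z}
  {hP₂ : ∀ B : (ConnectedPart (BTemp X₂.Pi))ᵒᵖ, IsPerfect (tf₂.Φ.carrier B)}
  {A₂ : tf₂.category}
  {hA₂ : PreFrobenioid.IsFrobeniusTrivial tf₂.toElem A₂} {hA₂' : SemiGraphs.IsGaloisObj A₂.base.obj}

/-- **T44-L15b AT THE FAITHFUL SLOT ⟸ [AbsAnab] Lem 1.3.8 ONLY**: for the settings `mkOfConnectedTemperoid` whose `(N, H)`-saturation slot IS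
«∃ (H normal) (H open), `def22Ctx A` is `(N, H)`-saturated ([FrdII] Def 2.2 (ii))», and any `h : Thm44Hyp` between them, `Ψ` preserves
`(N, H^{bs-fld}_⊙)`-saturated Frobenius-trivial objects.  p461844's closer with both readings `Iff` by proof irrelevance.
[cite: MochizukiEtTh2009, Thm 4.4 (iii) p.95] -/
theorem Thm44Hyp.preservesNHSaturatedBsFld_faithfulSlot {haug₁ : IsOpenMap X₁.aug} {haug₂ : IsOpenMap X₂.aug}
    {act₁ : ∀ A : tf₁.category, MulDistribMulAction (Aut (TemperedFrobenioid.AE X₁ tf₁ haug₁ A)) ↥(tf₁.units A)}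
    {hact₁ : ∀ (A : tf₁.category) (α : Aut A) (u : ↥(tf₁.units A)),
      (TemperedFrobenioid.resE X₁ tf₁ haug₁ A α) • u =
        (⟨α * u.1 * α⁻¹, (tf₁.units_normal A).conj_mem _ u.2 α⟩ : ↥(tf₁.units A))}
    {act₂ : ∀ B : tf₂.category, MulDistribMulAction (Aut (TemperedFrobenioid.AE X₂ tf₂ haug₂ B)) ↥(tf₂.units B)}
    {hact₂ : ∀ (B : tf₂.category) (α : Aut B) (u : ↥(tf₂.units B)),
      (TemperedFrobenioid.resE X₂ tf₂ haug₂ B α) • u =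
        (⟨α * u.1 * α⁻¹, (tf₂.units_normal B).conj_mem _ u.2 α⟩ : ↥(tf₂.units B))}
    (h : Thm44Hyp
      (mkOfConnectedTemperoid X₁ tf₁ hZ₁ hP₁
        (fun H A N => ∃ (hn : H.Normal) (ho : IsOpen (H : Set (Field.absoluteGaloisGroup K))),
        PadicKummer.IsNHSaturated (TemperedFrobenioid.def22Ctx X₁ tf₁ haug₁ A (act₁ A) (hact₁ A) H hn ho) N)
        A₁ hA₁ hA₁')
      (mkOfConnectedTemperoid X₂ tf₂ hZ₂ hP₂
        (fun H A N => ∃ (hn : H.Normal) (ho : IsOpen (H : Set (Field.absoluteGaloisGroup K'))),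
        PadicKummer.IsNHSaturated (TemperedFrobenioid.def22Ctx X₂ tf₂ haug₂ A (act₂ A) (hact₂ A) H hn ho) N)
        A₂ hA₂ hA₂'))
    (hΔ : ∀ θ : X₁.Pi ≃ₜ* X₂.Pi, X₁.delta.map θ.toMulEquiv.toMonoidHom = X₂.delta) :
    h.PreservesNHSaturatedBsFld :=
  h.preservesNHSaturatedBsFld_mkOfConnectedTemperoid_faithful hΔ haug₁ haug₂ act₁ hact₁ act₂ hact₂
    (fun _ _ => ⟨fun ⟨_, _, hs⟩ => hs, fun hs => ⟨_, _, hs⟩⟩) (fun _ _ => ⟨fun ⟨_, _, hs⟩ => hs, fun hs => ⟨_, _, hs⟩⟩)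

/-! ### [EtTh] Thm 4.4 at tree vocabulary, at the faithful slot -/

section TreeVocab

variable {Kt : Type} [Field Kt] {Kt' : Type} [Field Kt'] {Y₁ : SemiGraphs.TemperedArithmeticGroup.{0} Kt}
  {Y₂ : SemiGraphs.TemperedArithmeticGroup.{0} Kt'} {E₀ : Type} [Category.{0} E₀] {E₀' : Type}
  [Category.{0} E₀'] {U₁ : RealifiedDivisorMonoids (D₀ := E₀) treeMonoidVocab.{0}}
  {U₂ : RealifiedDivisorMonoids (D₀ := E₀') treeMonoidVocab.{0}}
  {IsRational₁ IsStrictlyRational₁ : ((ConnectedPart (BTemp Y₁.Pi))ᵒᵖ ⥤ CommMonCat.{0}) → Prop}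
  {IsRational₂ IsStrictlyRational₂ : ((ConnectedPart (BTemp Y₂.Pi))ᵒᵖ ⥤ CommMonCat.{0}) → Prop}
  {sf₁ : TemperedFrobenioid U₁ (ConnectedPart (BTemp Y₁.Pi))
    (treeCatVocab (ConnectedPart (BTemp Y₁.Pi)) IsRational₁ IsStrictlyRational₁)}
  {hZ₁ : sf₁.monoidType = MonoidType.Z} {hP₁ : ∀ A : (ConnectedPart (BTemp Y₁.Pi))ᵒᵖ, IsPerfect (sf₁.Φ.carrier A)}
  {A₁ : sf₁.category}
  {hA₁ : PreFrobenioid.IsFrobeniusTrivial sf₁.toElem A₁} {hA₁' : SemiGraphs.IsGaloisObj A₁.base.obj}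
  {sf₂ : TemperedFrobenioid U₂ (ConnectedPart (BTemp Y₂.Pi))
    (treeCatVocab (ConnectedPart (BTemp Y₂.Pi)) IsRational₂ IsStrictlyRational₂)}
  {hZ₂ : sf₂.monoidType = MonoidType.Z} {hP₂ : ∀ B : (ConnectedPart (BTemp Y₂.Pi))ᵒᵖ, IsPerfect (sf₂.Φ.carrier B)}
  {A₂ : sf₂.category}
  {hA₂ : PreFrobenioid.IsFrobeniusTrivial sf₂.toElem A₂} {hA₂' : SemiGraphs.IsGaloisObj A₂.base.obj}

/-- **[EtTh] Thm 4.4 (i) ∧ (ii) ∧ (iii) ∧ (`N`-th roots) at the GENUINE connected base, (N,H)-saturation slot = the FAITHFUL [FrdII] Def 2.2 (ii)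
reading through `def22Ctx`** — abc-iut-w5-d179's `thm44_mkOfConnectedTemperoid_of_baseInj` (p436787) with `h15` (T44-L15b) DISCHARGED by
`preservesNHSaturatedBsFld_faithfulSlot`: residual = {«`C_i` Frobenioid», T44-L03 `h3`, `hBD₁`/`hBD₂`, `hΔ` ([AbsAnab] Lem 1.3.8)}; the settings carry
`haug_i`, `act_i`/`hact_i`. [cite: MochizukiEtTh2009, Thm 4.4 p.94] -/
theorem Thm44Hyp.thm44_mkOfConnectedTemperoid_faithfulSlot {haug₁ : IsOpenMap Y₁.aug} {haug₂ : IsOpenMap Y₂.aug}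
    {act₁ : ∀ A : sf₁.category, MulDistribMulAction (Aut (TemperedFrobenioid.AE Y₁ sf₁ haug₁ A)) ↥(sf₁.units A)}
    {hact₁ : ∀ (A : sf₁.category) (α : Aut A) (u : ↥(sf₁.units A)),
      (TemperedFrobenioid.resE Y₁ sf₁ haug₁ A α) • u =
        (⟨α * u.1 * α⁻¹, (sf₁.units_normal A).conj_mem _ u.2 α⟩ : ↥(sf₁.units A))}
    {act₂ : ∀ B : sf₂.category, MulDistribMulAction (Aut (TemperedFrobenioid.AE Y₂ sf₂ haug₂ B)) ↥(sf₂.units B)}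
    {hact₂ : ∀ (B : sf₂.category) (α : Aut B) (u : ↥(sf₂.units B)),
      (TemperedFrobenioid.resE Y₂ sf₂ haug₂ B α) • u =
        (⟨α * u.1 * α⁻¹, (sf₂.units_normal B).conj_mem _ u.2 α⟩ : ↥(sf₂.units B))}
    (h : Thm44Hyp
      (mkOfConnectedTemperoid Y₁ sf₁ hZ₁ hP₁
        (fun H A N => ∃ (hn : H.Normal) (ho : IsOpen (H : Set (Field.absoluteGaloisGroup Kt))),
        PadicKummer.IsNHSaturated (TemperedFrobenioid.def22Ctx Y₁ sf₁ haug₁ A (act₁ A) (hact₁ A) H hn ho) N)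
        A₁ hA₁ hA₁')
      (mkOfConnectedTemperoid Y₂ sf₂ hZ₂ hP₂
        (fun H A N => ∃ (hn : H.Normal) (ho : IsOpen (H : Set (Field.absoluteGaloisGroup Kt'))),
        PadicKummer.IsNHSaturated (TemperedFrobenioid.def22Ctx Y₂ sf₂ haug₂ A (act₂ A) (hact₂ A) H hn ho) N)
        A₂ hA₂ hA₂'))
    (hF₁ : PreFrobenioid.IsFrobenioid sf₁.toElem) (hF₂ : PreFrobenioid.IsFrobenioid sf₂.toElem)
    (h3 : h.PreservesFrobeniusStructure)
    (hBD₁ : ∀ {A B : ConnectedPart (BTemp Y₁.Pi)} (α : B ⟶ A),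
      Function.Injective (U₁.BΛ.map (sf₁.base.map α).op).hom)
    (hBD₂ : ∀ {A B : ConnectedPart (BTemp Y₂.Pi)} (α : B ⟶ A),
      Function.Injective (U₂.BΛ.map (sf₂.base.map α).op).hom)
    (hΔ : ∀ θ : Y₁.Pi ≃ₜ* Y₂.Pi, Y₁.delta.map θ.toMulEquiv.toMonoidHom = Y₂.delta) :
    Thm44_i h ∧ Thm44_ii h (h.psiModel hF₁ hF₂ h3) ∧ Thm44_iii h (h.psiModel hF₁ hF₂ h3) ∧
      h.PreservesNthRoots (h.psiModel hF₁ hF₂ h3) (fun φ f => sf₁.pullFracModel φ f)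
        (fun φ f => sf₂.pullFracModel φ f) :=
  h.thm44_mkOfConnectedTemperoid_of_baseInj _ _ _ _ _ _ _ _ _ _ _ _ _ _ hF₁ hF₂ h3 hBD₁ hBD₂
    (h.preservesNHSaturatedBsFld_faithfulSlot hΔ)

end TreeVocab

end BiKummerSetting

end Literature.AnabelianGeometry.EtaleTheta

end
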